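/-
Copyright (c) 2026 the pub-hodgecm-mathlib formalisation cell (harness21).  Prover seat hodgecm-mathlib-K2Liu-p08 (g0), Track B «K2-LIT»,
#184♮ = hLiu418 = `stmt-HodgeConjecture-24832`; LEAD F0P6-plan (g11) RE-DEAL #33b (D) 2026-09-04T05:43:59Z «(D-fin) → K2Liu-p08 (g0)» after
K2E2-p12 (g3)'s spec of record `K2/K2E2-p12/g3/HANDOFF-33b-D.K2E2-p12-g3.md` 9b449ffef0601ea6 §«What remains» 1.  Inputs ★ (B-iii)
`K2LiuSiegelBigCellOpenEmbeddingPi`, ★ (D0) p857685 `K2LiuSiegelCharLocLocallyConstant`, ★ (D2) `K2LiuEquivariantLocallyConstantOpenStabilizer`.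
-/
import Summits.HodgeConjecture.HodgeConjecture.Theorems.K2LiuSiegelBigCellOpenEmbeddingPi              -- ★ (B-iii): open map, injectivity, `P_Δ` closed
import Summits.HodgeConjecture.HodgeConjecture.Theorems.K2LiuSiegelCharLocLocallyConstant             -- ★ (D0) p857685: `exists_isOpen_siegelCharLoc_eq`
import Summits.HodgeConjecture.HodgeConjecture.Theorems.K2LiuEquivariantLocallyConstantOpenStabilizer -- ★ (D2): `exists_isOpen_subgroup_mul_right_invariant`
import Literature.NumberTheory.Automorphic.CMPrincipalSeriesJacquetEvalOne                              -- ★ `nonarchimedeanGroup_unitaryGroupOfForm_local`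
import HarnessLib

/-!
# Crux `HLiu418`, road `K2_Liu`, socket #33b organ (D-fin): the LOCAL SIEGEL SECTION `φ_v = δ_v ⊗ g_v` supported in the main orbit
# `Ω_v = P_Δ(L⁺_v) · ι_v(U(V)(L⁺_v), 1)` at a finite place `v`

Cell `hodgecm-mathlib`, crux item hLiu418 = `stmt-HodgeConjecture-24832`; LEAD F0P6-plan, box K2E5-r01 (g6); consumer = the #33b closer
`Theorems/K2LiuSiegelBigCellSection.lean` (K2Liu-p11 (g0)), conjuncts at the places `v ∈ S` of WORDS-33b.  THEOREMS ONLY (no `def`, no instance,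
no notation, no named-fact hypothesis, no `sorry`); lane `--supports stmt-HodgeConjecture-24832 --as helper` (count-neutral).

THE RECIPE ([GelbartPiatetskishapiroRallis1987, Part A §1]: sections of `Ind_{P_Δ}^{H} δ` supported on the open main orbit; [Liu2011, §2C p. 863]).
`H_v := localPi … (n + n) (hermD …) v`, `P := siegelDeltaLoc … v`, `δ := siegelCharLoc … v χ s` (multiplicative on `P`, ★ `siegelCharLoc_mul`, LOCALLY CONSTANT
on `P`, ★ (D0) `exists_isOpen_siegelCharLoc_eq`), `G_v := localPi … N (diagonal dV) v`, `ι := iotaLeftLocPi … v : G_v →* H_v`, and the chart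
`m(p, g) := p · ι(g)` — INJECTIVE and OPEN (★ (B-iii) `injective_∕isOpenMap_siegelDeltaLoc_mul_iotaLeftLocPi`, `W` a line: `dW 0 ≠ 0`; `dV i ≠ 0`).
Given `g_v : G_v → ℂ` locally constant vanishing off a compact `C`, put `φ(m(p, g)) := δ(p) · g_v(g)` on the range of `m` and `φ := 0` off it.  Then
(`exists_siegel_localSection`): (i) `φ(p · u) = δ(p) · φ(u)` for `p ∈ P` (the range of `m` is left-`P`-stable both ways); (ii) `φ` is LOCALLY CONSTANT —
near `m(p₀, g₀)` on the OPEN set `m((O ∩ P) × g_v⁻¹{g_v g₀})` (`O` from (D0)), and near a point off the range on the complement of the CLOSED set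
`P · ι(C)` (★ `isClosed_siegelDeltaLoc` × compact, `IsClosed.mul_right_of_isCompact`), where `φ = 0`; (iii) read-back `φ(ι g) = g_v(g)` (`δ(1) = 1`);
(iv) `φ = 0` off `P · ι(C)`.  With the basis of open subgroups of `H_v` (★ `nonarchimedeanGroup_unitaryGroupOfForm_local` transported along ★ `localPiEquiv`:
`exists_isOpen_subgroup_subset`) the generic ★ (D2) `exists_isOpen_subgroup_mul_right_invariant` then yields an OPEN SUBGROUP `K′_v ≤ H_v` with
`φ(u · k) = φ(u)` (`exists_siegel_localSection_rightInvariant`) — the `∃ K′` conjunct of WORDS-33b at `v ∈ S`; and §3 packages it with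
the BUMP `g_v` = indicator of a compact open subgroup of `U(V)(L⁺_v)` inside a given `U_v ∋ 1` (`exists_siegel_localSection_package` = the closer's
by-value hypothesis `hFin` at `v`, K2Liu-p11 (g0) REPORT-33b-CLOSER).

[GelbartPiatetskishapiroRallis1987, Part A §1–§2] [Liu2011, §2C p. 863] [BorelJacquet1979, §4.1] [HarrisKudlaSweet1996, §1 (1.11), (1.15)].
HONEST LABEL.  Count-neutral helper; `HC_CM` is proved only modulo the 7 printed citations (2 remaining named inputs: hLiu418 =
`stmt-HodgeConjecture-24832`, h413 = `stmt-HodgeConjecture-24833`) until rung 0 closes.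
-/

set_option autoImplicit false
set_option linter.dupNamespace false -- the mandated namespace repeats `HodgeConjecture.HodgeConjecture`

noncomputable section

namespace Summit.HodgeConjecture.HodgeConjecture.Cruxes.HLiu418.K2LiuSiegelMainOrbitLocalSection

open scoped Matrix Pointwise
open Topology Filter
open NumberField IsDedekindDomain
open Literature.NumberTheory.Automorphic
open Literature.NumberTheory.GelbartRogawski1991 Literature.NumberTheory.GelbartRogawski1991.GRConstruction
open Literature.NumberTheory.GaloisRepresentations
open Literature.NumberTheory.K2Lit.SiegelDoubled
open Summit.HodgeConjecture.HodgeConjecture.Cruxes.HLiu418.K2LiuSiegelBigCellOpenEmbeddingPi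
open Summit.HodgeConjecture.HodgeConjecture.Cruxes.HLiu418.K2LiuSiegelCharLocLocallyConstant (exists_isOpen_siegelCharLoc_eq)
open Summit.HodgeConjecture.HodgeConjecture.Cruxes.HLiu418.K2LiuEquivariantLocallyConstantOpenStabilizer
  (exists_isOpen_subgroup_mul_right_invariant)

variable (L : Type) [Field L] [NumberField L] [IsCMField L]
variable {N n : ℕ} (e : Fin N × Fin 1 ≃ Fin n)
  (dV : Fin N → L) (hdV : ∀ i, IsCMField.complexConj L (dV i) = dV i)
  (dW : Fin 1 → L) (hdW : ∀ i, IsCMField.complexConj L (dW i) = dW i)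
  (v : HeightOneSpectrum (𝓞 (Fp L)))

/-! ## §1 `H(L⁺_v)` has a basis of open subgroups at `1` -/

/-- **every neighbourhood of `1` in a local unitary group `U(J)(L⁺_v) = localPi … K J v` contains an OPEN SUBGROUP** (★
`nonarchimedeanGroup_unitaryGroupOfForm_local` for the «local» form, transported along the ★ isomorphism of topological groups `localPiEquiv`).
The hypothesis `hK` of ★ (D2); used for `H(L⁺_v)` (`K = n + n`, `J = J^𝔻`) and for `U(V)(L⁺_v)` (`K = N`, `J = diagonal dV`). [cite: PlatonovRapinchuk1994, §3.3] -/
theorem exists_isOpen_subgroup_subset {K : ℕ} (J : Matrix (Fin K) (Fin K) L)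
    (U : Set (UnitaryGroup.localPi L (IsCMField.complexConj L) K J v))
    (hU : U ∈ 𝓝 (1 : UnitaryGroup.localPi L (IsCMField.complexConj L) K J v)) :
    ∃ K₀ : Subgroup (UnitaryGroup.localPi L (IsCMField.complexConj L) K J v),
      IsOpen (K₀ : Set (UnitaryGroup.localPi L (IsCMField.complexConj L) K J v)) ∧
        (K₀ : Set (UnitaryGroup.localPi L (IsCMField.complexConj L) K J v)) ⊆ U := by
  haveI : NonarchimedeanGroup (UnitaryGroup.«local» L (IsCMField.complexConj L) K J v) :=
    UnitaryGroup.nonarchimedeanGroup_unitaryGroupOfForm_local (E := L) (c := IsCMField.complexConj L) (N := K) (v := v)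
      (J' := (UnitaryGroup.adelicForm L K J).map (UnitaryGroup.adeleToLocal L v))
  set Φ := UnitaryGroup.localPiEquiv L (IsCMField.complexConj L) K J v with hΦ
  have hc : Continuous fun y => Φ.symm y := map_continuous Φ.symm
  have hU' : (fun y => Φ.symm y) ⁻¹' U ∈ 𝓝 (1 : UnitaryGroup.«local» L (IsCMField.complexConj L) K J v) := by
    refine hc.continuousAt.preimage_mem_nhds ?_
    show U ∈ 𝓝 (Φ.symm 1)
    rw [map_one]
    exact hU
  obtain ⟨V, hV⟩ := NonarchimedeanGroup.is_nonarchimedean _ hU'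
  let K₀ : Subgroup (UnitaryGroup.localPi L (IsCMField.complexConj L) K J v) :=
    (V : Subgroup (UnitaryGroup.«local» L (IsCMField.complexConj L) K J v)).comap Φ.toMonoidHom
  have hKo : IsOpen (K₀ : Set (UnitaryGroup.localPi L (IsCMField.complexConj L) K J v)) := by
    show IsOpen ((fun x => Φ x) ⁻¹' ((V : Subgroup (UnitaryGroup.«local» L (IsCMField.complexConj L) K J v)) : Set _))
    exact V.isOpen.preimage (map_continuous Φ)
  refine ⟨K₀, hKo, fun k hk => ?_⟩
  have hk' : Φ k ∈ ((V : Subgroup (UnitaryGroup.«local» L (IsCMField.complexConj L) K J v)) : Set _) := hk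
  have := hV hk'
  rwa [Set.mem_preimage, ContinuousMulEquiv.symm_apply_apply] at this

/-- **a compact open subgroup of `U(J)(L⁺_v)` inside any neighbourhood of `1`** (an open subgroup of `exists_isOpen_subgroup_subset` cut by the compact open
★ `localInt v`; open subgroups are closed). [cite: PlatonovRapinchuk1994, §3.3] -/
theorem exists_isOpen_isCompact_subgroup_subset {K : ℕ} (J : Matrix (Fin K) (Fin K) L)
    (U : Set (UnitaryGroup.localPi L (IsCMField.complexConj L) K J v))
    (hU : U ∈ 𝓝 (1 : UnitaryGroup.localPi L (IsCMField.complexConj L) K J v)) :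
    ∃ K₀ : Subgroup (UnitaryGroup.localPi L (IsCMField.complexConj L) K J v),
      IsOpen (K₀ : Set (UnitaryGroup.localPi L (IsCMField.complexConj L) K J v)) ∧
        IsCompact (K₀ : Set (UnitaryGroup.localPi L (IsCMField.complexConj L) K J v)) ∧
          (K₀ : Set (UnitaryGroup.localPi L (IsCMField.complexConj L) K J v)) ⊆ U := by
  obtain ⟨K₁, hK₁o, hK₁U⟩ := exists_isOpen_subgroup_subset L v J U hU
  have hKo : IsOpen ((K₁ ⊓ UnitaryGroup.localInt L (IsCMField.complexConj L) K J v :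
      Subgroup (UnitaryGroup.localPi L (IsCMField.complexConj L) K J v)) : Set (UnitaryGroup.localPi L (IsCMField.complexConj L) K J v)) := by
    rw [Subgroup.coe_inf]
    exact hK₁o.inter (UnitaryGroup.isOpen_localInt L (IsCMField.complexConj L) K J v)
  refine ⟨K₁ ⊓ UnitaryGroup.localInt L (IsCMField.complexConj L) K J v, hKo,
    (UnitaryGroup.isCompact_localInt L (IsCMField.complexConj L) K J v).of_isClosed_subset (Subgroup.isClosed_of_isOpen _ hKo) ?_,
    fun k hk => hK₁U (Subgroup.mem_inf.1 hk).1⟩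
  rw [Subgroup.coe_inf]
  exact Set.inter_subset_right

/-- the indicator of a clopen set is locally constant (value type `ℝ`). [folklore] -/
theorem isLocallyConstant_indicator_one_of_isOpen_of_isClosed {X : Type*} [TopologicalSpace X] {K₀ : Set X}
    (ho : IsOpen K₀) (hc : IsClosed K₀) : IsLocallyConstant (K₀.indicator fun _ => (1 : ℝ)) := by
  classical
  refine (IsLocallyConstant.iff_exists_open _).2 fun x => ?_
  by_cases hx : x ∈ K₀
  · exact ⟨K₀, ho, hx, fun y hy => by rw [Set.indicator_of_mem hy, Set.indicator_of_mem hx]⟩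
  · exact ⟨K₀ᶜ, hc.isOpen_compl, hx, fun y hy => by rw [Set.indicator_of_notMem hy, Set.indicator_of_notMem hx]⟩

/-! ## §2 The local Siegel section supported in the main orbit -/

/-- **THE LOCAL SIEGEL SECTION `φ_v = δ_v ⊗ g_v` ON THE MAIN ORBIT** (`W` a line, `dW 0 ≠ 0`; `dV i ≠ 0`): for `g_v : U(V)(L⁺_v) → ℂ` locally constant
vanishing off a compact `C`, there is `φ : H(L⁺_v) → ℂ`, left-`(P_Δ(L⁺_v), δ_v)`-equivariant, LOCALLY CONSTANT, with `φ(ι_v(g, 1)) = g_v(g)` and `φ = 0` off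
`P_Δ(L⁺_v) · ι_v(C, 1)`. [cite: GelbartPiatetskishapiroRallis1987, Part A §1–§2] [cite: Liu2011, §2C p. 863] [cite: HarrisKudlaSweet1996, §1 (1.15)] -/
theorem exists_siegel_localSection (hdV0 : ∀ i, dV i ≠ 0) (hdW0 : ∀ i, dW i ≠ 0) (χ : HeckeCharacter L) (s : ℂ)
    (gv : UnitaryGroup.localPi L (IsCMField.complexConj L) N (Matrix.diagonal dV) v → ℂ) (hg : IsLocallyConstant gv)
    {C : Set (UnitaryGroup.localPi L (IsCMField.complexConj L) N (Matrix.diagonal dV) v)} (hC : IsCompact C)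
    (hgC : ∀ x, x ∉ C → gv x = 0) :
    ∃ φ : UnitaryGroup.localPi L (IsCMField.complexConj L) (n + n) (hermD L e dV hdV dW hdW) v → ℂ,
      (∀ p ∈ siegelDeltaLoc L e dV hdV dW hdW v, ∀ u, φ (p * u) = siegelCharLoc L e dV hdV dW hdW v χ s p * φ u) ∧
      IsLocallyConstant φ ∧
      (∀ g, φ (iotaLeftLocPi L e dV hdV dW hdW v g) = gv g) ∧
      (∀ u, u ∉ (siegelDeltaLoc L e dV hdV dW hdW v :
          Set (UnitaryGroup.localPi L (IsCMField.complexConj L) (n + n) (hermD L e dV hdV dW hdW) v)) *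
            ((fun g => iotaLeftLocPi L e dV hdV dW hdW v g) '' C) → φ u = 0) := by
  classical
  -- the chart `m (p, g) = p · ι(g)`: injective, open
  let m : ↥(siegelDeltaLoc L e dV hdV dW hdW v) × UnitaryGroup.localPi L (IsCMField.complexConj L) N (Matrix.diagonal dV) v →
      UnitaryGroup.localPi L (IsCMField.complexConj L) (n + n) (hermD L e dV hdV dW hdW) v :=
    fun px => (px.1 : UnitaryGroup.localPi L (IsCMField.complexConj L) (n + n) (hermD L e dV hdV dW hdW) v) *
      iotaLeftLocPi L e dV hdV dW hdW v px.2
  have hinj : Function.Injective m := injective_siegelDeltaLoc_mul_iotaLeftLocPi L e dV hdV dW hdW v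
  have hopen : IsOpenMap m :=
    isOpenMap_siegelDeltaLoc_mul_iotaLeftLocPi L e dV hdV dW hdW v hdW0 (isUnit_det_pairFormLoc L dV dW v hdV0 hdW0)
  let δ : UnitaryGroup.localPi L (IsCMField.complexConj L) (n + n) (hermD L e dV hdV dW hdW) v → ℂ :=
    siegelCharLoc L e dV hdV dW hdW v χ s
  let φ : UnitaryGroup.localPi L (IsCMField.complexConj L) (n + n) (hermD L e dV hdV dW hdW) v → ℂ :=
    fun u => if h : ∃ px, m px = u then δ (h.choose.1 : _) * gv h.choose.2 else 0
  -- value on the chart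
  have hφm : ∀ px, φ (m px) = δ (px.1 : _) * gv px.2 := by
    intro px
    have h : ∃ px', m px' = m px := ⟨px, rfl⟩
    have hc : h.choose = px := hinj h.choose_spec
    show (if h : ∃ px', m px' = m px then δ (h.choose.1 : _) * gv h.choose.2 else 0) = _
    rw [dif_pos h, hc]
  have hφ0 : ∀ u, (¬ ∃ px, m px = u) → φ u = 0 := fun u hu => by
    show (if h : ∃ px, m px = u then δ (h.choose.1 : _) * gv h.choose.2 else 0) = 0
    rw [dif_neg hu]
  -- left translation by `P` preserves the chart: `p · m (p', g) = m (p p', g)`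
  have hmulm : ∀ (p : UnitaryGroup.localPi L (IsCMField.complexConj L) (n + n) (hermD L e dV hdV dW hdW) v)
      (hp : p ∈ siegelDeltaLoc L e dV hdV dW hdW v) (px : ↥(siegelDeltaLoc L e dV hdV dW hdW v) ×
        UnitaryGroup.localPi L (IsCMField.complexConj L) N (Matrix.diagonal dV) v),
      p * m px = m (⟨p, hp⟩ * px.1, px.2) := fun p hp px => by
    show p * ((px.1 : UnitaryGroup.localPi L (IsCMField.complexConj L) (n + n) (hermD L e dV hdV dW hdW) v) *
      iotaLeftLocPi L e dV hdV dW hdW v px.2) = (p * (px.1 : _)) * iotaLeftLocPi L e dV hdV dW hdW v px.2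
    rw [mul_assoc]
  refine ⟨φ, fun p hp u => ?_, ?_, fun g => ?_, fun u hu => ?_⟩
  · -- (i) equivariance
    by_cases hu : ∃ px, m px = u
    · obtain ⟨px, rfl⟩ := hu
      rw [hmulm p hp px, hφm, hφm]
      show δ (p * (px.1 : _)) * gv px.2 = δ p * (δ (px.1 : _) * gv px.2)
      rw [← mul_assoc]
      exact congrArg (· * gv px.2) (siegelCharLoc_mul L e dV hdV dW hdW v χ s hp px.1.2)
    · have hpu : ¬ ∃ px, m px = p * u := by
        rintro ⟨px, hpx⟩
        refine hu ⟨(⟨p, hp⟩⁻¹ * px.1, px.2), ?_⟩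
        have h1 := hmulm p⁻¹ (inv_mem hp) px
        rw [hpx, ← mul_assoc, inv_mul_cancel, one_mul] at h1
        rw [h1]
        rfl
      rw [hφ0 _ hpu, hφ0 _ hu, mul_zero]
  · -- (ii) local constancy
    refine (IsLocallyConstant.iff_exists_open φ).2 fun u => ?_
    by_cases hu : ∃ px, m px = u
    · obtain ⟨⟨p₀, g₀⟩, rfl⟩ := hu
      obtain ⟨O, hOo, hp₀O, hO⟩ := exists_isOpen_siegelCharLoc_eq L e dV hdV dW hdW v χ s (p₀ : _) p₀.2
      refine ⟨m '' ((Subtype.val ⁻¹' O) ×ˢ (gv ⁻¹' {gv g₀})),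
        hopen _ ((hOo.preimage continuous_subtype_val).prod (hg.isOpen_fiber _)),
        ⟨(p₀, g₀), ⟨hp₀O, rfl⟩, rfl⟩, ?_⟩
      rintro _ ⟨⟨p, g⟩, ⟨hpO, hgg⟩, rfl⟩
      rw [hφm, hφm]
      have hδ : δ (p : _) = δ (p₀ : _) := hO _ hpO p.2
      have hgg' : gv g = gv g₀ := hgg
      show δ (p : _) * gv g = δ (p₀ : _) * gv g₀
      rw [hδ, hgg']
    · have hZ : IsClosed ((siegelDeltaLoc L e dV hdV dW hdW v :
          Set (UnitaryGroup.localPi L (IsCMField.complexConj L) (n + n) (hermD L e dV hdV dW hdW) v)) *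
            ((fun g => iotaLeftLocPi L e dV hdV dW hdW v g) '' C)) :=
        (isClosed_siegelDeltaLoc L e dV hdV dW hdW v).mul_right_of_isCompact
          (hC.image (continuous_iotaLeftLocPi L e dV hdV dW hdW v))
      have huZ : u ∉ (siegelDeltaLoc L e dV hdV dW hdW v :
          Set (UnitaryGroup.localPi L (IsCMField.complexConj L) (n + n) (hermD L e dV hdV dW hdW) v)) *
            ((fun g => iotaLeftLocPi L e dV hdV dW hdW v g) '' C) := by
        rintro ⟨p, hp, _, ⟨g, -, rfl⟩, rfl⟩
        exact hu ⟨(⟨p, hp⟩, g), rfl⟩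
      refine ⟨((siegelDeltaLoc L e dV hdV dW hdW v :
          Set (UnitaryGroup.localPi L (IsCMField.complexConj L) (n + n) (hermD L e dV hdV dW hdW) v)) *
            ((fun g => iotaLeftLocPi L e dV hdV dW hdW v g) '' C))ᶜ, hZ.isOpen_compl, huZ, fun u' hu' => ?_⟩
      have h0 : ∀ w, w ∉ (siegelDeltaLoc L e dV hdV dW hdW v :
          Set (UnitaryGroup.localPi L (IsCMField.complexConj L) (n + n) (hermD L e dV hdV dW hdW) v)) *
            ((fun g => iotaLeftLocPi L e dV hdV dW hdW v g) '' C) → φ w = 0 := by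
        intro w hw
        by_cases hw' : ∃ px, m px = w
        · obtain ⟨⟨p, g⟩, rfl⟩ := hw'
          have hgC' : g ∉ C := fun hgC' => hw ⟨p, p.2, _, ⟨g, hgC', rfl⟩, rfl⟩
          rw [hφm]
          show δ (p : _) * gv g = 0
          rw [hgC g hgC', mul_zero]
        · exact hφ0 w hw'
      rw [h0 u' hu', h0 u huZ]
  · -- (iii) read-back along `ι`
    have h1 : iotaLeftLocPi L e dV hdV dW hdW v g = m (1, g) := by
      show _ = ((1 : ↥(siegelDeltaLoc L e dV hdV dW hdW v)) : UnitaryGroup.localPi L (IsCMField.complexConj L) (n + n)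
        (hermD L e dV hdV dW hdW) v) * iotaLeftLocPi L e dV hdV dW hdW v g
      rw [OneMemClass.coe_one, one_mul]
    rw [h1, hφm]
    show δ ((1 : ↥(siegelDeltaLoc L e dV hdV dW hdW v)) : _) * gv g = gv g
    rw [OneMemClass.coe_one]
    show siegelCharLoc L e dV hdV dW hdW v χ s 1 * gv g = gv g
    rw [siegelCharLoc_one, one_mul]
  · -- (iv) support
    by_cases hu' : ∃ px, m px = u
    · obtain ⟨⟨p, g⟩, rfl⟩ := hu'
      have hgC' : g ∉ C := fun hgC' => hu ⟨p, p.2, _, ⟨g, hgC', rfl⟩, rfl⟩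
      rw [hφm]
      show δ (p : _) * gv g = 0
      rw [hgC g hgC', mul_zero]
    · exact hφ0 u hu'

/-- **THE LOCAL SIEGEL SECTION WITH ITS OPEN STABILISER** — the `v ∈ S` conjuncts of #33b: `φ` as in `exists_siegel_localSection` AND an OPEN SUBGROUP
`K′ ≤ H(L⁺_v)` with `φ(u · k) = φ(u)` for all `u`, `k ∈ K′` (★ (D2) `exists_isOpen_subgroup_mul_right_invariant` over §1).
[cite: GelbartPiatetskishapiroRallis1987, Part A §1–§2] [cite: BorelJacquet1979, §4.1] [cite: Liu2011, §2C p. 863] -/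
theorem exists_siegel_localSection_rightInvariant (hdV0 : ∀ i, dV i ≠ 0) (hdW0 : ∀ i, dW i ≠ 0) (χ : HeckeCharacter L) (s : ℂ)
    (gv : UnitaryGroup.localPi L (IsCMField.complexConj L) N (Matrix.diagonal dV) v → ℂ) (hg : IsLocallyConstant gv)
    {C : Set (UnitaryGroup.localPi L (IsCMField.complexConj L) N (Matrix.diagonal dV) v)} (hC : IsCompact C)
    (hgC : ∀ x, x ∉ C → gv x = 0) :
    ∃ (φ : UnitaryGroup.localPi L (IsCMField.complexConj L) (n + n) (hermD L e dV hdV dW hdW) v → ℂ)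
      (K' : Subgroup (UnitaryGroup.localPi L (IsCMField.complexConj L) (n + n) (hermD L e dV hdV dW hdW) v)),
      IsOpen (K' : Set (UnitaryGroup.localPi L (IsCMField.complexConj L) (n + n) (hermD L e dV hdV dW hdW) v)) ∧
      (∀ p ∈ siegelDeltaLoc L e dV hdV dW hdW v, ∀ u, φ (p * u) = siegelCharLoc L e dV hdV dW hdW v χ s p * φ u) ∧
      IsLocallyConstant φ ∧
      (∀ g, φ (iotaLeftLocPi L e dV hdV dW hdW v g) = gv g) ∧
      (∀ u, u ∉ (siegelDeltaLoc L e dV hdV dW hdW v :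
          Set (UnitaryGroup.localPi L (IsCMField.complexConj L) (n + n) (hermD L e dV hdV dW hdW) v)) *
            ((fun g => iotaLeftLocPi L e dV hdV dW hdW v g) '' C) → φ u = 0) ∧
      (∀ u, ∀ k ∈ K', φ (u * k) = φ u) := by
  obtain ⟨φ, hφP, hloc, hι, hsupp⟩ := exists_siegel_localSection L e dV hdV dW hdW v hdV0 hdW0 χ s gv hg hC hgC
  obtain ⟨K', hK'o, hK'⟩ := exists_isOpen_subgroup_mul_right_invariant (exists_isOpen_subgroup_subset L v (hermD L e dV hdV dW hdW))
    (siegelDeltaLoc L e dV hdV dW hdW v) (siegelCharLoc L e dV hdV dW hdW v χ s) φ hφP hloc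
    (hC.image (continuous_iotaLeftLocPi L e dV hdV dW hdW v)) hsupp
  exact ⟨φ, K', hK'o, hφP, hloc, hι, hsupp, hK'⟩

/-! ## §3 The finite section package of #33b at `v` (the closer's `hFin`, one place at a time) -/

/-- **THE FINITE SECTION PACKAGE OF #33b AT A PLACE `v`** (the by-value hypothesis `hFin` of the closer `siegelBigCellSection_of_localPackages`, K2Liu-p11
(g0) REPORT-33b-CLOSER): for every open `U_v ∋ 1` of `U(V)(L⁺_v)` there are an OPEN SUBGROUP `K′_v ≤ H(L⁺_v)`, a left-`(P_Δ, δ_v)`-equivariant LOCALLY CONSTANT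
right-`K′_v`-invariant `φ_v : H(L⁺_v) → ℂ`, and a continuous compactly supported BUMP `g_v ≥ 0` on `U(V)(L⁺_v)` with `supp g_v ⊆ U_v`, `g_v(1) > 0` (the indicator of a
compact open subgroup inside `U_v`) such that `φ_v(ι_v(x, 1)) = g_v(x)`. [cite: GelbartPiatetskishapiroRallis1987, Part A §1–§2] [cite: Liu2011, §2C p. 863]
[cite: BorelJacquet1979, §4.1] -/
theorem exists_siegel_localSection_package (hdV0 : ∀ i, dV i ≠ 0) (hdW0 : ∀ i, dW i ≠ 0) (χ : HeckeCharacter L) (s : ℂ)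
    (Uv : Set (UnitaryGroup.localPi L (IsCMField.complexConj L) N (Matrix.diagonal dV) v)) (hUo : IsOpen Uv)
    (h1 : (1 : UnitaryGroup.localPi L (IsCMField.complexConj L) N (Matrix.diagonal dV) v) ∈ Uv) :
    ∃ (K'v : Subgroup (UnitaryGroup.localPi L (IsCMField.complexConj L) (n + n) (hermD L e dV hdV dW hdW) v))
      (φv : UnitaryGroup.localPi L (IsCMField.complexConj L) (n + n) (hermD L e dV hdV dW hdW) v → ℂ)
      (gv : UnitaryGroup.localPi L (IsCMField.complexConj L) N (Matrix.diagonal dV) v → ℝ),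
      IsOpen (K'v : Set (UnitaryGroup.localPi L (IsCMField.complexConj L) (n + n) (hermD L e dV hdV dW hdW) v)) ∧
      (∀ p ∈ siegelDeltaLoc L e dV hdV dW hdW v, ∀ u, φv (p * u) = siegelCharLoc L e dV hdV dW hdW v χ s p * φv u) ∧
      IsLocallyConstant φv ∧ (∀ u, ∀ k ∈ K'v, φv (u * k) = φv u) ∧
      (∀ x, φv (iotaLeftLocPi L e dV hdV dW hdW v x) = ((gv x : ℝ) : ℂ)) ∧
      Continuous gv ∧ HasCompactSupport gv ∧ 0 ≤ gv ∧ Function.support gv ⊆ Uv ∧ 0 < gv 1 := by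
  classical
  obtain ⟨K₀, hK₀o, hK₀c, hK₀U⟩ := exists_isOpen_isCompact_subgroup_subset L v (Matrix.diagonal dV) Uv (hUo.mem_nhds h1)
  have hK₀cl : IsClosed (K₀ : Set (UnitaryGroup.localPi L (IsCMField.complexConj L) N (Matrix.diagonal dV) v)) :=
    Subgroup.isClosed_of_isOpen _ hK₀o
  let gv : UnitaryGroup.localPi L (IsCMField.complexConj L) N (Matrix.diagonal dV) v → ℝ :=
    (K₀ : Set (UnitaryGroup.localPi L (IsCMField.complexConj L) N (Matrix.diagonal dV) v)).indicator fun _ => (1 : ℝ)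
  have hgloc : IsLocallyConstant gv := isLocallyConstant_indicator_one_of_isOpen_of_isClosed hK₀o hK₀cl
  have hgC : ∀ x, x ∉ (K₀ : Set (UnitaryGroup.localPi L (IsCMField.complexConj L) N (Matrix.diagonal dV) v)) →
      (fun x => ((gv x : ℝ) : ℂ)) x = 0 := fun x hx => by
    show ((gv x : ℝ) : ℂ) = 0
    rw [show gv x = 0 from Set.indicator_of_notMem hx _, Complex.ofReal_zero]
  obtain ⟨φ, K', hK'o, hφP, hloc, hι, -, hK'⟩ := exists_siegel_localSection_rightInvariant L e dV hdV dW hdW v hdV0 hdW0 χ s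
    (fun x => ((gv x : ℝ) : ℂ)) (hgloc.comp (fun r : ℝ => (r : ℂ))) hK₀c hgC
  refine ⟨K', φ, gv, hK'o, hφP, hloc, hK', hι, hgloc.continuous, ?_, ?_, ?_, ?_⟩
  · exact HasCompactSupport.intro' hK₀c hK₀cl fun x hx => Set.indicator_of_notMem hx _
  · exact fun x => Set.indicator_nonneg (fun _ _ => zero_le_one) x
  · exact (Set.support_indicator_subset).trans hK₀U
  · show 0 < (K₀ : Set (UnitaryGroup.localPi L (IsCMField.complexConj L) N (Matrix.diagonal dV) v)).indicator (fun _ => (1 : ℝ)) 1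
    rw [Set.indicator_of_mem (K₀.one_mem)]
    exact one_pos

end Summit.HodgeConjecture.HodgeConjecture.Cruxes.HLiu418.K2LiuSiegelMainOrbitLocalSection

end
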